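import Summits.CriticalPhenomena.PercolationContinuityZ3.Theorems.Transplant.KNParaChainAppendN
import Summits.CriticalPhenomena.PercolationContinuityZ3.Theorems.Transplant.KNParaChainLocN
import Summits.CriticalPhenomena.PercolationContinuityZ3.Theorems.Transplant.PlanarCells2Contain
import HarnessLib

/-!
# N1 (the `{±1}` node), LEVEL 1, (C) column file (C-N5): THE PLANAR CORRIDOR SCHEDULES of the two-frame (C) corridor (design of record: lane
# VERDICT / lead ruling 2026-08-21 13:56:39Z (i), HOME/prim-bschramm-p5-g8/C-FUNNEL.md §2–§4; κ ≤ 10 from p3-g8's orientation lemma (L0-5)):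
# * segment 1 (over the cell map, two-unit cells `P : PCells2`): the signed v-ROUNDS `P₁.scheduleN 1 (P.cen y) hP₁` of a localisation record
#   `P₁ : ChainPara.LocPrm` in cell units — start box `⊇ M_y`, regions `⊆ Q_y`, last core = one stride along axis `1`;
# * segment 2 (over the run frame, origin `0`): the signed u-ROUNDS `P₂.scheduleN 0 0 hP₂` APPENDED WITH CONTAINMENT JOIN (`appendN'`: first
#   core of the band `⊇` last core of the rounds, inside the rounds' last region) to the BAND `B.scheduleN aB (σ := 1) 0 hB heb` of a fixed-stride run
#   `B : ChainPara.RunPrm` along the corridor axis `aB` (u-corridor: `aB = 0`; v-corridor: `aB = 1`, drift `v_α`).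
# Pure `Site 2` / `ℤ`; the vertex-level rooms of segment 2 (run boxes read into the cell map) and the cross link are the frame-change files.

builds on p205010 (kernel theorem, internal audit signed; external expert review pending) — nothing in this file uses p205010; nothing here is a
claim about the open node `SamePDropOfSkeletonNeg`.
Lane `prim-bschramm`, seat `prim-bschramm-p5` (gen 8; (C) lineage); helper file (`--supports stmt-CriticalPhenomena-4575`).
* §1 **`ScheduleN.appendN'`** (containment join: `hjoin : S₁.core (N₁+1) ⊆ S₂.core 0`, `hreg : S₂.core 0 ⊆ S₁.region N₁`) + `appendN'_params/_left/_right/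
  _core_zero/_core_last`;
* §2 segment 1: `phase1_core_zero_supset_M`, `phase1_region_subset_Q`, `phase1_mem_core_last` (cell units; `PCells2` boxes);
* §3 segment 2: **`ChainPara.corrRunSched P₂ hP₂ B aB hB heb hjoin hreg`**, `corrRunSched_params`, `corrRunSched_core_zero`, `corrRunSched_core_last`,
  `corrRunSched_left/_right`, and the two JOIN lemmas `join_x` (`aB = 0`: `L₂(N₂+1) ≤ q`, `Wk₂(N₂+1) ≤ Wm, Wp`) / `join_y` (`aB = 1`: `Wk₂(N₂+1) ≤ q`,
  `L₂(N₂+1) ≤ Wm, Wp`) with the matching `joinReg_x/_y`.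
[cite: KozmaNitzan2024, §4 Lemma 12 (pp. 23–25), p. 26 (M_v, Q_v, H_{v,x})] [cite: MartineauTassion2017, §4.3 Lemma 4.2]
-/

noncomputable section

namespace Summit.CriticalPhenomena.PercolationContinuityZ3.Theorems

namespace Transplant

namespace ChainPlanar

open Literature.Probability.Percolation Literature.Probability.LatticeModels
open Literature.Probability.Percolation.KozmaNitzan
open Literature.Probability.Percolation.KozmaNitzan.Cells (oth oth_ne eq_oth_of_ne)

/-! ## §1 Appending with a containment join -/

namespace ScheduleN

/-- **Appending two slab-target schedules with a CONTAINMENT join**: as `appendN`, but the first core of `S₂` only CONTAINS the last core of `S₁`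
and lies in the last region of `S₁` (the band's start window may be wider than the localised box). [cite: KozmaNitzan2024, §4 Lemma 12 (pp. 23–25)] -/
def appendN' (S₁ S₂ : ScheduleN) (hR : S₂.R' = S₁.R') (hjoin : S₁.core (S₁.N + 1) ⊆ S₂.core 0) (hreg : S₂.core 0 ⊆ S₁.region S₁.N) : ScheduleN where
  ax := pw S₁.N S₁.ax S₂.ax
  lo := pw S₁.N S₁.lo S₂.lo
  hi := pw S₁.N S₁.hi S₂.hi
  region := pw S₁.N S₁.region S₂.region
  prism := S₁.prism ∪ S₂.prism
  N := S₁.N + 1 + S₂.N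
  R' := S₁.R'
  sLo := pw S₁.N S₁.sLo S₂.sLo
  sHi := pw S₁.N S₁.sHi S₂.sHi
  d := pw S₁.N S₁.d S₂.d
  Pp := pw S₁.N S₁.Pp S₂.Pp
  Pm := pw S₁.N S₁.Pm S₂.Pm
  La := pw S₁.N S₁.La S₂.La
  Lb := pw S₁.N S₁.Lb S₂.Lb
  encl k hk := by
    by_cases h : k ≤ S₁.N
    · simp only [pw_of_le _ _ h]
      exact S₁.encl k h
    · obtain ⟨j, rfl⟩ : ∃ j, k = S₁.N + 1 + j := ⟨k - (S₁.N + 1), by omega⟩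
      simp only [pw_add, ← hR]
      exact S₂.encl j (by omega)
  succ k hk := by
    by_cases h : k + 1 ≤ S₁.N
    · simp only [pw_of_le _ _ h, pw_of_le _ _ (Nat.le_of_succ_le h)]
      exact S₁.succ k (Nat.le_of_succ_le h)
    · by_cases h' : k = S₁.N
      · subst h'
        rw [pw_of_le _ _ le_rfl, pw_of_not_le _ _ (by omega), pw_of_not_le _ _ (by omega), Nat.sub_self]
        exact hreg
      · obtain ⟨j, rfl⟩ : ∃ j, k = S₁.N + 1 + j := ⟨k - (S₁.N + 1), by omega⟩
        simp only [pw_add, pw_add_succ]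
        exact S₂.succ j (by omega)
  sub_prism k hk := by
    by_cases h : k ≤ S₁.N
    · simp only [pw_of_le _ _ h]
      exact (S₁.sub_prism k h).trans Finset.subset_union_left
    · obtain ⟨j, rfl⟩ : ∃ j, k = S₁.N + 1 + j := ⟨k - (S₁.N + 1), by omega⟩
      simp only [pw_add]
      exact (S₂.sub_prism j (by omega)).trans Finset.subset_union_right
  nonempty k hk := by
    by_cases h : k ≤ S₁.N
    · simp only [pw_of_le _ _ h]
      exact S₁.nonempty k (by omega)
    · obtain ⟨j, rfl⟩ : ∃ j, k = S₁.N + 1 + j := ⟨k - (S₁.N + 1), by omega⟩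
      simp only [pw_add]
      exact S₂.nonempty j (by omega)
  route k hk v hv := by
    by_cases h : k ≤ S₁.N
    · simp only [pw_of_le _ _ h] at hv ⊢
      obtain ⟨σ, hσ, hlink, τ, hτ, hland⟩ := S₁.route k h v hv
      refine ⟨σ, hσ, hlink, τ, hτ, fun y e1 e2 e3 => ?_⟩
      have hy := hland y e1 e2 e3
      by_cases h' : k + 1 ≤ S₁.N
      · simp only [pw_of_le _ _ h']
        exact hy
      · have ek : k = S₁.N := by omega
        subst ek
        rw [pw_of_not_le _ _ (by omega), pw_of_not_le _ _ (by omega), Nat.sub_self]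
        exact hjoin hy
    · obtain ⟨j, rfl⟩ : ∃ j, k = S₁.N + 1 + j := ⟨k - (S₁.N + 1), by omega⟩
      simp only [pw_add, pw_add_succ, ← hR] at hv ⊢
      exact S₂.route j (by omega) v hv

variable (S₁ S₂ : ScheduleN) (hR : S₂.R' = S₁.R') (hjoin : S₁.core (S₁.N + 1) ⊆ S₂.core 0) (hreg : S₂.core 0 ⊆ S₁.region S₁.N)

/-- Parameters of the containment-joined schedule. [folklore] -/
theorem appendN'_params : (S₁.appendN' S₂ hR hjoin hreg).N = S₁.N + 1 + S₂.N ∧ (S₁.appendN' S₂ hR hjoin hreg).R' = S₁.R' ∧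
    (S₁.appendN' S₂ hR hjoin hreg).prism = S₁.prism ∪ S₂.prism :=
  ⟨rfl, rfl, rfl⟩

/-- The first steps (`k ≤ N₁`) of the containment-joined schedule are the steps of `S₁`. [folklore] -/
theorem appendN'_left {k : ℕ} (hk : k ≤ S₁.N) :
    (S₁.appendN' S₂ hR hjoin hreg).ax k = S₁.ax k ∧ (S₁.appendN' S₂ hR hjoin hreg).region k = S₁.region k ∧
    (∀ i, (S₁.appendN' S₂ hR hjoin hreg).level k i = S₁.level k i) ∧ (S₁.appendN' S₂ hR hjoin hreg).core k = S₁.core k ∧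
    (S₁.appendN' S₂ hR hjoin hreg).sLo k = S₁.sLo k ∧ (S₁.appendN' S₂ hR hjoin hreg).sHi k = S₁.sHi k ∧ (S₁.appendN' S₂ hR hjoin hreg).d k = S₁.d k ∧
    (S₁.appendN' S₂ hR hjoin hreg).Pp k = S₁.Pp k ∧ (S₁.appendN' S₂ hR hjoin hreg).Pm k = S₁.Pm k ∧ (S₁.appendN' S₂ hR hjoin hreg).La k = S₁.La k ∧
    (S₁.appendN' S₂ hR hjoin hreg).Lb k = S₁.Lb k := by
  refine ⟨pw_of_le _ _ hk, pw_of_le _ _ hk, fun i => ?_, ?_, pw_of_le _ _ hk, pw_of_le _ _ hk, pw_of_le _ _ hk, pw_of_le _ _ hk,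
    pw_of_le _ _ hk, pw_of_le _ _ hk, pw_of_le _ _ hk⟩
  · show Finset.Icc (pw S₁.N S₁.lo S₂.lo k - ((i : ℕ) : Site 2)) (pw S₁.N S₁.hi S₂.hi k + ((i : ℕ) : Site 2)) = _
    rw [pw_of_le _ _ hk, pw_of_le _ _ hk]; rfl
  · show Finset.Icc (pw S₁.N S₁.lo S₂.lo k) (pw S₁.N S₁.hi S₂.hi k) = _
    rw [pw_of_le _ _ hk, pw_of_le _ _ hk]; rfl

/-- The later steps (`N₁ + 1 + j`) of the containment-joined schedule are the steps of `S₂` at `j`. [folklore] -/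
theorem appendN'_right (j : ℕ) :
    (S₁.appendN' S₂ hR hjoin hreg).ax (S₁.N + 1 + j) = S₂.ax j ∧ (S₁.appendN' S₂ hR hjoin hreg).region (S₁.N + 1 + j) = S₂.region j ∧
    (∀ i, (S₁.appendN' S₂ hR hjoin hreg).level (S₁.N + 1 + j) i = S₂.level j i) ∧ (S₁.appendN' S₂ hR hjoin hreg).core (S₁.N + 1 + j) = S₂.core j ∧
    (S₁.appendN' S₂ hR hjoin hreg).sLo (S₁.N + 1 + j) = S₂.sLo j ∧ (S₁.appendN' S₂ hR hjoin hreg).sHi (S₁.N + 1 + j) = S₂.sHi j ∧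
    (S₁.appendN' S₂ hR hjoin hreg).d (S₁.N + 1 + j) = S₂.d j ∧ (S₁.appendN' S₂ hR hjoin hreg).Pp (S₁.N + 1 + j) = S₂.Pp j ∧
    (S₁.appendN' S₂ hR hjoin hreg).Pm (S₁.N + 1 + j) = S₂.Pm j ∧ (S₁.appendN' S₂ hR hjoin hreg).La (S₁.N + 1 + j) = S₂.La j ∧
    (S₁.appendN' S₂ hR hjoin hreg).Lb (S₁.N + 1 + j) = S₂.Lb j := by
  refine ⟨pw_add _ _ _ _, pw_add _ _ _ _, fun i => ?_, ?_, pw_add _ _ _ _, pw_add _ _ _ _, pw_add _ _ _ _, pw_add _ _ _ _, pw_add _ _ _ _,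
    pw_add _ _ _ _, pw_add _ _ _ _⟩
  · show Finset.Icc (pw S₁.N S₁.lo S₂.lo (S₁.N + 1 + j) - ((i : ℕ) : Site 2)) (pw S₁.N S₁.hi S₂.hi (S₁.N + 1 + j) + ((i : ℕ) : Site 2)) = _
    rw [pw_add, pw_add]; rfl
  · show Finset.Icc (pw S₁.N S₁.lo S₂.lo (S₁.N + 1 + j)) (pw S₁.N S₁.hi S₂.hi (S₁.N + 1 + j)) = _
    rw [pw_add, pw_add]; rfl

/-- The first core of the containment-joined schedule is the first core of `S₁`. [folklore] -/
theorem appendN'_core_zero : (S₁.appendN' S₂ hR hjoin hreg).core 0 = S₁.core 0 := (appendN'_left S₁ S₂ hR hjoin hreg (Nat.zero_le _)).2.2.2.1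

/-- The last core of the containment-joined schedule is the last core of `S₂`. [folklore] -/
theorem appendN'_core_last : (S₁.appendN' S₂ hR hjoin hreg).core ((S₁.appendN' S₂ hR hjoin hreg).N + 1) = S₂.core (S₂.N + 1) := by
  rw [(appendN'_params S₁ S₂ hR hjoin hreg).1, show S₁.N + 1 + S₂.N + 1 = S₁.N + 1 + (S₂.N + 1) by omega,
    (appendN'_right S₁ S₂ hR hjoin hreg (S₂.N + 1)).2.2.2.1]

end ScheduleN

end ChainPlanar

/-! ## §2 Segment 1: the v-rounds over the two-unit cells -/

namespace ChainPara

open Literature.Probability.Percolation Literature.Probability.LatticeModels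
open Literature.Probability.Percolation.KozmaNitzan.Cells (oth oth_ne eq_oth_of_ne)
open ChainPlanar

section Phase1

variable (P : PCells2) (y : Site 2) (P₁ : LocPrm) (hP₁ : LocOK P₁)

/-- `oth 1 = 0` on `Fin 2`. [folklore] -/
private theorem oth_one : oth (1 : Fin 2) = 0 := by decide

/-- **The start box of the v-rounds contains the arrival box** `M_y = cen y ± (3r₀, 3r₁)` when `3r₁ ≤ L0` (along axis `1`) and `3r₀ ≤ W` (across).
[cite: KozmaNitzan2024, §4 p. 26 (M_v)] -/
theorem phase1_core_zero_supset_M (hL : 3 * (P.r 1 : ℤ) ≤ P₁.L0) (hW : 3 * (P.r 0 : ℤ) ≤ P₁.W) :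
    P.M y ⊆ (P₁.scheduleN 1 (P.cen y) hP₁).core 0 := by
  intro t ht
  rw [PCells2.M, PCells2.mem_abox_iff] at ht
  rw [LocPrm.mem_scheduleN_core_zero, oth_one]
  have h1 := ht 1; have h0 := ht 0
  push_cast at h1 h0
  exact ⟨abs_le.2 ⟨by linarith, by linarith⟩, abs_le.2 ⟨by linarith, by linarith⟩⟩

/-- **Every region of the v-rounds lies in the cube box** `Q_y = cen y ± (5r₀, 5r₁)` when `max L0 sHi + e + La ≤ 5r₁` and `W + N·e + e + Lb ≤ 5r₀`.
[cite: KozmaNitzan2024, §4 p. 26 (Q_v)] -/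
theorem phase1_region_subset_Q (hL : max (P₁.L0 : ℤ) P₁.sHi + P₁.e + P₁.La ≤ 5 * (P.r 1 : ℤ)) (hW : P₁.Wk P₁.N + P₁.e + P₁.Lb ≤ 5 * (P.r 0 : ℤ))
    {k : ℕ} (hk : k ≤ P₁.N) : (P₁.scheduleN 1 (P.cen y) hP₁).region k ⊆ P.Q y := by
  intro t ht
  rw [LocPrm.scheduleN_region, LocPrm.mem_pregion_iff, oth_one] at ht
  obtain ⟨ha, hb⟩ := ht
  rw [abs_le] at ha hb
  have hLk := LocPrm.L_le_max hP₁ k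
  have hWk := P₁.Wk_mono hk
  rw [PCells2.Q, PCells2.mem_abox_iff, Fin.forall_fin_two]
  push_cast
  exact ⟨⟨by linarith, by linarith⟩, by linarith, by linarith⟩

/-- **The last core of the v-rounds is ONE STRIDE along and the accumulated window across**: `|t₁ − cen₁| ≤ sHi`, `|t₀ − cen₀| ≤ W + (N+1)e`, once
`L0 ≤ sHi + (N+1)(sLo − e)`. [cite: KozmaNitzan2024, §4 Lemma 12 (pp. 23–25)] -/
theorem phase1_mem_core_last (hN : (P₁.L0 : ℤ) ≤ P₁.sHi + ((P₁.N : ℤ) + 1) * (P₁.sLo - P₁.e)) {t : Site 2} :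
    t ∈ (P₁.scheduleN 1 (P.cen y) hP₁).core (P₁.N + 1) ↔ |t 1 - P.cen y 1| ≤ P₁.sHi ∧ |t 0 - P.cen y 0| ≤ P₁.W + ((P₁.N : ℤ) + 1) * P₁.e := by
  rw [LocPrm.mem_scheduleN_core_last _ _ _ _ hN, oth_one]

end Phase1

/-! ## §3 Segment 2: the u-rounds appended to the band, in the run frame (origin `0`) -/

section Phase23

variable (P₂ : LocPrm) (hP₂ : LocOK P₂) (B : RunPrm) (aB : Fin 2) (hB : RunOK B) (heb : B.eb = B.ea)

/-- **Join of the u-rounds into an x-band** (`aB = 0`): the band's start box `{|y₀| ≤ q, −Wm ≤ y₁ ≤ Wp}` contains the rounds' last core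
`{|y₀| ≤ L₂(N₂+1), |y₁| ≤ Wk₂(N₂+1)}` when `L₂(N₂+1) ≤ q` and `Wk₂(N₂+1) ≤ Wm, Wp`. [folklore] -/
theorem join_x (hq : P₂.L (P₂.N + 1) ≤ B.q) (hWm : P₂.Wk (P₂.N + 1) ≤ B.Wm) (hWp : P₂.Wk (P₂.N + 1) ≤ B.Wp) :
    (P₂.scheduleN 0 0 hP₂).core (P₂.N + 1) ⊆ (B.scheduleN 0 (Or.inl rfl) 0 hB heb).core 0 := by
  intro t ht
  rw [LocPrm.mem_scheduleN_core_iff] at ht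
  rw [RunPrm.mem_scheduleN_core_zero]
  simp only [Pi.zero_apply, sub_zero, one_mul] at ht ⊢
  obtain ⟨ha, hb⟩ := ht
  rw [abs_le] at ha hb
  exact ⟨⟨by linarith, by linarith⟩, by linarith, by linarith⟩

/-- **Join of the u-rounds into a y′-band** (`aB = 1`): the band's start box `{|y₁| ≤ q, −Wm ≤ y₀ ≤ Wp}` contains the rounds' last core when
`Wk₂(N₂+1) ≤ q` and `L₂(N₂+1) ≤ Wm, Wp`. [folklore] -/
theorem join_y (hq : P₂.Wk (P₂.N + 1) ≤ B.q) (hWm : P₂.L (P₂.N + 1) ≤ B.Wm) (hWp : P₂.L (P₂.N + 1) ≤ B.Wp) :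
    (P₂.scheduleN 0 0 hP₂).core (P₂.N + 1) ⊆ (B.scheduleN 1 (Or.inl rfl) 0 hB heb).core 0 := by
  intro t ht
  rw [LocPrm.mem_scheduleN_core_iff] at ht
  rw [RunPrm.mem_scheduleN_core_zero]
  have h10 : oth (1 : Fin 2) = 0 := by decide
  have h01 : oth (0 : Fin 2) = 1 := by decide
  simp only [Pi.zero_apply, sub_zero, one_mul, h10, h01] at ht ⊢
  obtain ⟨ha, hb⟩ := ht
  rw [abs_le] at ha hb
  exact ⟨⟨by linarith, by linarith⟩, by linarith, by linarith⟩

/-- **The x-band's start box lies in the rounds' last region** (`aB = 0`): `q ≤ L₂ N₂ + e + La`, `Wm, Wp ≤ Wk₂ N₂ + e + Lb`. [folklore] -/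
theorem joinReg_x (hq : (B.q : ℤ) ≤ P₂.L P₂.N + P₂.e + P₂.La) (hWm : (B.Wm : ℤ) ≤ P₂.Wk P₂.N + P₂.e + P₂.Lb) (hWp : (B.Wp : ℤ) ≤ P₂.Wk P₂.N + P₂.e + P₂.Lb) :
    (B.scheduleN 0 (Or.inl rfl) 0 hB heb).core 0 ⊆ (P₂.scheduleN 0 0 hP₂).region P₂.N := by
  intro t ht
  rw [RunPrm.mem_scheduleN_core_zero] at ht
  rw [LocPrm.scheduleN_region, LocPrm.mem_pregion_iff]
  simp only [Pi.zero_apply, sub_zero, one_mul] at ht ⊢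
  obtain ⟨⟨ha1, ha2⟩, hb1, hb2⟩ := ht
  exact ⟨abs_le.2 ⟨by linarith, by linarith⟩, abs_le.2 ⟨by linarith, by linarith⟩⟩

/-- **The y′-band's start box lies in the rounds' last region** (`aB = 1`): `Wm, Wp ≤ L₂ N₂ + e + La`, `q ≤ Wk₂ N₂ + e + Lb`. [folklore] -/
theorem joinReg_y (hq : (B.q : ℤ) ≤ P₂.Wk P₂.N + P₂.e + P₂.Lb) (hWm : (B.Wm : ℤ) ≤ P₂.L P₂.N + P₂.e + P₂.La) (hWp : (B.Wp : ℤ) ≤ P₂.L P₂.N + P₂.e + P₂.La) :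
    (B.scheduleN 1 (Or.inl rfl) 0 hB heb).core 0 ⊆ (P₂.scheduleN 0 0 hP₂).region P₂.N := by
  intro t ht
  rw [RunPrm.mem_scheduleN_core_zero] at ht
  rw [LocPrm.scheduleN_region, LocPrm.mem_pregion_iff]
  have h10 : oth (1 : Fin 2) = 0 := by decide
  have h01 : oth (0 : Fin 2) = 1 := by decide
  simp only [Pi.zero_apply, sub_zero, one_mul, h10, h01] at ht ⊢
  obtain ⟨⟨ha1, ha2⟩, hb1, hb2⟩ := ht
  exact ⟨abs_le.2 ⟨by linarith, by linarith⟩, abs_le.2 ⟨by linarith, by linarith⟩⟩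

/-- **THE RUN-FRAME SEGMENT OF THE (C) CORRIDOR**: the signed u-rounds `P₂` (axis `0`, centre `0`) followed by the band `B` along `aB` (sign `1`,
origin `0`), joined by containment (`hjoin`, `hreg` — discharged by `join_x/joinReg_x` or `join_y/joinReg_y`). [cite: KozmaNitzan2024, §4 Lemma 12 (pp. 23–25)] -/
def corrRunSched (hR : B.ea = P₂.e)
    (hjoin : (P₂.scheduleN 0 0 hP₂).core (P₂.N + 1) ⊆ (B.scheduleN aB (Or.inl rfl) 0 hB heb).core 0)
    (hreg : (B.scheduleN aB (Or.inl rfl) 0 hB heb).core 0 ⊆ (P₂.scheduleN 0 0 hP₂).region P₂.N) : ScheduleN :=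
  (P₂.scheduleN 0 0 hP₂).appendN' (B.scheduleN aB (Or.inl rfl) 0 hB heb) hR hjoin hreg

variable (hR : B.ea = P₂.e) (hjoin : (P₂.scheduleN 0 0 hP₂).core (P₂.N + 1) ⊆ (B.scheduleN aB (Or.inl rfl) 0 hB heb).core 0)
  (hreg : (B.scheduleN aB (Or.inl rfl) 0 hB heb).core 0 ⊆ (P₂.scheduleN 0 0 hP₂).region P₂.N)

/-- Parameters of the run-frame segment: `N = N₂ + 1 + B.N`, `R' = e`, prism `= pprism₂ ∪ B.pprism`. [folklore] -/
theorem corrRunSched_params : (corrRunSched P₂ hP₂ B aB hB heb hR hjoin hreg).N = P₂.N + 1 + B.N ∧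
    (corrRunSched P₂ hP₂ B aB hB heb hR hjoin hreg).R' = P₂.e ∧
    (corrRunSched P₂ hP₂ B aB hB heb hR hjoin hreg).prism = P₂.pprism 0 0 ∪ B.pprism aB 1 0 :=
  ⟨rfl, rfl, rfl⟩

/-- The first core of the run-frame segment is the rounds' start box `{|y₀| ≤ L0₂, |y₁| ≤ W₂}`. [folklore] -/
theorem corrRunSched_core_zero : (corrRunSched P₂ hP₂ B aB hB heb hR hjoin hreg).core 0 = P₂.pcore 0 0 0 :=
  ScheduleN.appendN'_core_zero _ _ hR hjoin hreg

/-- The last core of the run-frame segment is the band's last core. [folklore] -/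
theorem corrRunSched_core_last : (corrRunSched P₂ hP₂ B aB hB heb hR hjoin hreg).core ((corrRunSched P₂ hP₂ B aB hB heb hR hjoin hreg).N + 1) =
    B.pcore aB 1 0 (B.N + 1) :=
  ScheduleN.appendN'_core_last _ _ hR hjoin hreg

/-- The rounds' steps of the run-frame segment (`k ≤ N₂`): axis `0`, region `pregion₂ k`, core `pcore₂ k`. [folklore] -/
theorem corrRunSched_left {k : ℕ} (hk : k ≤ P₂.N) : (corrRunSched P₂ hP₂ B aB hB heb hR hjoin hreg).ax k = 0 ∧
    (corrRunSched P₂ hP₂ B aB hB heb hR hjoin hreg).region k = P₂.pregion 0 0 k ∧ (corrRunSched P₂ hP₂ B aB hB heb hR hjoin hreg).core k = P₂.pcore 0 0 k := by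
  have h := ScheduleN.appendN'_left (P₂.scheduleN 0 0 hP₂) (B.scheduleN aB (Or.inl rfl) 0 hB heb) hR hjoin hreg hk
  exact ⟨h.1, h.2.1, h.2.2.2.1⟩

/-- The band's steps of the run-frame segment (`N₂ + 1 + j`): axis `aB`, region `B.pregion j`, core `B.pcore j`. [folklore] -/
theorem corrRunSched_right (j : ℕ) : (corrRunSched P₂ hP₂ B aB hB heb hR hjoin hreg).ax (P₂.N + 1 + j) = aB ∧
    (corrRunSched P₂ hP₂ B aB hB heb hR hjoin hreg).region (P₂.N + 1 + j) = B.pregion aB 1 0 j ∧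
    (corrRunSched P₂ hP₂ B aB hB heb hR hjoin hreg).core (P₂.N + 1 + j) = B.pcore aB 1 0 j := by
  have h := ScheduleN.appendN'_right (P₂.scheduleN 0 0 hP₂) (B.scheduleN aB (Or.inl rfl) 0 hB heb) hR hjoin hreg j
  exact ⟨h.1, h.2.1, h.2.2.2.1⟩

end Phase23

end ChainPara

end Transplant

end Summit.CriticalPhenomena.PercolationContinuityZ3.Theorems

end
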